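import Literature.Geometry.Kaehler.ComplexTorusFourierWeylOperatorClosedForm
import HarnessLib

/-!
# The Weyl operator of a polarised complex torus on Hodge types: `w(H^{r,s}(X)) = H^{g−s, g−r}(X)`

Layer `Literature/Geometry/Kaehler`, namespace `Literature.Geometry.Kaehler.ComplexTorus`; lane `lit-hodgefound` (Track 2 foundations
library), prover seat `lit-hodgefound-p09` (generation 51, row g51-#10). THEOREMS ONLY (no definition, no named fact, no instance, no
notation; D-0026 net debt `0`).

SETTING. `X = E/Φ(ℤ^ι)` a complex torus of dimension `g` with a Riemann form `η` (a polarised complex torus = abelian variety),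
`w = (hasLefschetzProperty_lefschetzG hη).weylOperator isZGrading_countingG = exp(Λ_η) exp(−L_η) exp(Λ_η)` the Weyl operator of the
Lefschetz `𝔰𝔩₂` on `H•(X; ℂ) = GForm E ℂ`, and `IsOfTypeAt r s x` the tree's pointwise Hodge type of an invariant form (`x ∈ H^{r,s}(X)`).

By row g51-#4 `φ_H^* ∘ F = (−1)^g χ(d)·w` (`η` of type `d`), so `w(x)_{2g−k} = (−1)^g χ(d)⁻¹ · φ_H^*F(x)`; Lange's Proposition 6.2.21
"`F(H^{r,s}(X)) = H^{g−s,g−r}(X̂)`" (`isOfTypeAt_fourierForm`) and the `ℂ`-linearity of `φ_H : V → Ω̄` (pull-back by a `ℂ`-linear map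
preserves types) give the Hodge types of the Weyl operator ON `X` ITSELF:

* §1 **`IsRiemannForm.isOfTypeAt_weylOperator_of`: `x ∈ H^{r,s}(X) ⇒ w(x)_{2g−k} ∈ H^{g−s, g−r}(X)`** (`r + s = k`; any Riemann form `η`,
  any lattice frame), and `IsRiemannForm.weylOperator_of_eq_of` (`w(x)` IS its component of degree `2g − k`);
* §2 **`IsRiemannForm.image_weylOperator_setOf_isOfTypeAt`: `w(H^{r,s}(X)) = H^{g−s, g−r}(X)`** — equality of sets of invariant forms,
  surjectivity from `w² = (−1)^{k−g}` on `Hᵏ` (`weylOperator_weylOperator_apply_of_mem`).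

So `w` is an isomorphism of the real Hodge structure `Hᵏ(X)` onto `H^{2g−k}(X)` shifting the bigrading by `(g−k, g−k)` — the
cohomological shadow, on the abelian variety itself, of "`F` is an isomorphism of Hodge structures `Hᵏ(X) → H^{2g−k}(X̂)(g−k)`".

## Sources

* H. Lange, *Abelian Varieties over the Complex Numbers* (2023) [Lange2023AbelianVarietiesComplex], §6.2.4 Prop. 6.2.21 (p. 311):
  "`F(H^{r,s}(X)) = H^{g−s,g−r}(X̂)`"; Prop. 6.2.20 (p. 310); §1.4.2 Lemma 1.4.5 (`φ_H` is `ℂ`-linear).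
* A. Polishchuk (2007) [Polishchuk2007FourierStable], §1 Lemma 1.4 (p. 3) (`(−1)^g F_d = exp(e)exp(−f)exp(e)`).
* E. Looijenga, V. Lunts, *A Lie algebra attached to a projective variety* (1997) [LooijengaLunts1997], §1 (1.6)–(1.8) (the Lefschetz
  `𝔰𝔩₂` commutes with the Hodge structure operators; `w` preserves the total Lie algebra's weight structure).
* C. Voisin, *Hodge Theory and Complex Algebraic Geometry I* (2002) [Voisin2002], §7.3.2 (pull-back by holomorphic maps preserves types).
-/

noncomputable section

-- `Module ℂ` / `SMulZeroClass ℂ` synthesis on `E [⋀^Fin k]→L[ℝ] ℂ` (as in `ComplexTorusLefschetzDecomposition`)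
set_option maxSynthPendingDepth 3

namespace Literature.Geometry.Kaehler

namespace ComplexTorus

open Module Function Finset
open Literature.LinearAlgebra.Alternating Literature.Algebra.Lie Literature.Analysis.Complex

universe uE

variable {ι : Type*} [Fintype ι] [DecidableEq ι] {E : Type uE} [NormedAddCommGroup E] [NormedSpace ℂ E]
  [FiniteDimensional ℂ E] [Nontrivial E] (Φ : (ι → ℝ) ≃L[ℝ] E) {η : E [⋀^Fin 2]→L[ℝ] ℝ} {N : ℕ}

/-! ## §1 `w` lowers the Hodge type `(r, s)` to `(g − s, g − r)` -/

section Types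

/-- **`w(x)_{2g−k} = (−1)^g χ(d)⁻¹ · φ_H^*F(x)`**: the degree-`m` component of the Weyl operator on `x ∈ Hᵏ(X; ℂ)`, `k + m = 2g`, for a
Riemann form of type `d` (row g51-#4 read componentwise; `φ_H = phiHRep`). [cite: Polishchuk2007FourierStable, §1 Lemma 1.4 (p. 3)]
[cite: Lange2023AbelianVarietiesComplex, §6.2.4 Prop. 6.2.20 p. 310] -/
theorem IsPolarizationType.weylOperator_of_apply (hR : IsRiemannForm Φ η) {g : ℕ} {d : Fin g → ℕ} (hd : IsPolarizationType Φ η d)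
    (hη : ∀ v : E, v ≠ 0 → ∃ w : E, η ![v, w] ≠ 0) (e : Fin N ≃ ι) {k m : ℕ} (h : k + m = N) (x : E [⋀^Fin k]→L[ℝ] ℂ) :
    (hasLefschetzProperty_lefschetzG hη).weylOperator isZGrading_countingG (GForm.of k x) m =
      ((-1 : ℂ) ^ g * (∏ i, (d i : ℂ))⁻¹) • (fourierForm Φ e h x).compContinuousLinearMap ((phiHRep Φ hR.1).restrictScalars ℝ) := by
  have hχ : (∏ i, (d i : ℂ)) ≠ 0 := prod_ne_zero_iff.2 fun i _ ↦ by exact_mod_cast (hd.pos hR i).ne'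
  have key := congr_fun (hd.of_fourierForm_compContinuousLinearMap Φ hR hη ((phiHRep Φ hR.1).restrictScalars ℝ)
    (fun u w ↦ im_phiHFun η u w) e h x) m
  rw [GForm.of_apply_self, Pi.smul_apply] at key
  rw [key, smul_smul, mul_mul_mul_comm, ← pow_add, ← two_mul, pow_mul, neg_one_sq, one_pow, one_mul, inv_mul_cancel₀ hχ, one_smul]

omit [Fintype ι] [DecidableEq ι] in
/-- **`w(x)` is homogeneous: `w(x) = (w(x)_{2g−k})` placed in degree `m = 2g − k`** for `x ∈ Hᵏ(X; ℂ)`.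
[cite: Andre1996Motifs, §1.2 (p. 11)] -/
theorem weylOperator_of_eq_of (hη : ∀ v : E, v ≠ 0 → ∃ w : E, η ![v, w] ≠ 0) {k m : ℕ} (h : k + m = 2 * finrank ℂ E)
    (x : E [⋀^Fin k]→L[ℝ] ℂ) :
    (hasLefschetzProperty_lefschetzG hη).weylOperator isZGrading_countingG (GForm.of k x) =
      GForm.of m ((hasLefschetzProperty_lefschetzG hη).weylOperator isZGrading_countingG (GForm.of k x) m) :=
  (isHomog_weylOperator_of hη h x).eq_of

/-- **`w(H^{r,s}(X)) ⊆ H^{g−s, g−r}(X)`**: for a polarised complex torus (`η` a Riemann form) and `x ∈ Hᵏ(X; ℂ)` of Hodge type `(r, s)`,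
the Weyl operator's value `w(x)_{2g−k}` has type `(g − s, g − r)` — from `w(x)_{2g−k} = ± χ⁻¹ φ_H^*F(x)`, Lange's Prop. 6.2.21
`F(H^{r,s}(X)) = H^{g−s,g−r}(X̂)` and the `ℂ`-linearity of `φ_H`. Stated with `r' + s = g`, `s' + r = g`.
[cite: Lange2023AbelianVarietiesComplex, §6.2.4 Prop. 6.2.21 p. 311; §1.4.2 Lemma 1.4.5] [cite: Voisin2002, §7.3.2] [cite: LooijengaLunts1997, §1 (1.6)–(1.8)] -/
theorem IsRiemannForm.isOfTypeAt_weylOperator_of (hR : IsRiemannForm Φ η) (hη : ∀ v : E, v ≠ 0 → ∃ w : E, η ![v, w] ≠ 0)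
    (e : Fin N ≃ ι) {k m : ℕ} (h : k + m = N) {r s r' s' : ℕ} {x : E [⋀^Fin k]→L[ℝ] ℂ} (hx : IsOfTypeAt r s x)
    (hr' : r' + s = finrank ℂ E) (hs' : s' + r = finrank ℂ E) :
    IsOfTypeAt r' s' ((hasLefschetzProperty_lefschetzG hη).weylOperator isZGrading_countingG (GForm.of k x) m) := by
  obtain ⟨g, d, hd, -⟩ := hR.exists_isPolarizationType
  rw [hd.weylOperator_of_apply Φ hR hη e h x]
  exact ((isOfTypeAt_fourierForm Φ e h hx hr' hs').compContinuousLinearMap _ fun c w ↦ by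
    rw [ContinuousLinearMap.coe_restrictScalars', map_smul]).smul _

/-- **`w(Hdg) ⊆ Hdg` on types: `x ∈ H^{p,p}(X) ⇒ w(x)_{2g−2p} ∈ H^{g−p, g−p}(X)`.** [cite: Lange2023AbelianVarietiesComplex, §6.2.4 Prop. 6.2.21 p. 311] -/
theorem IsRiemannForm.isOfTypeAt_weylOperator_of_self (hR : IsRiemannForm Φ η) (hη : ∀ v : E, v ≠ 0 → ∃ w : E, η ![v, w] ≠ 0)
    (e : Fin N ≃ ι) {k m : ℕ} (h : k + m = N) {p p' : ℕ} {x : E [⋀^Fin k]→L[ℝ] ℂ} (hx : IsOfTypeAt p p x)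
    (hp' : p' + p = finrank ℂ E) :
    IsOfTypeAt p' p' ((hasLefschetzProperty_lefschetzG hη).weylOperator isZGrading_countingG (GForm.of k x) m) :=
  hR.isOfTypeAt_weylOperator_of Φ hη e h hx hp' hp'

end Types

/-! ## §2 `w(H^{r,s}(X)) = H^{g−s, g−r}(X)` -/

section Image

omit [Fintype ι] [DecidableEq ι] [FiniteDimensional ℂ E] [Nontrivial E] in
/-- `(−1)^{|k−g|} (−1)^{|k−g|} = 1`. [folklore] -/
private theorem neg_one_pow_natAbs_mul_self₅₈ (n : ℤ) : (-1 : ℂ) ^ n.natAbs * (-1) ^ n.natAbs = 1 := by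
  rw [← pow_add, ← two_mul, pow_mul, neg_one_sq, one_pow]

/-- **`w(H^{r,s}(X)) = H^{g−s, g−r}(X)`** (equality of sets of invariant forms; `r + s = k`, `k + m = 2g`, `r' = g − s`, `s' = g − r`):
every form of type `(g−s, g−r)` in degree `2g − k` is `w(x)_{2g−k}` for a (unique) `x ∈ H^{r,s}(X)`, namely `x = ± w(y)_k`
(`w² = (−1)^{k−g}` on `Hᵏ`). [cite: Lange2023AbelianVarietiesComplex, §6.2.4 Prop. 6.2.21 p. 311] [cite: Andre1996Motifs, §1.2 (p. 11)] -/
theorem IsRiemannForm.image_weylOperator_setOf_isOfTypeAt (hR : IsRiemannForm Φ η) (hη : ∀ v : E, v ≠ 0 → ∃ w : E, η ![v, w] ≠ 0)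
    (e : Fin N ≃ ι) {k m : ℕ} (h : k + m = N) {r s r' s' : ℕ} (hrs : r + s = k) (hr' : r' + s = finrank ℂ E)
    (hs' : s' + r = finrank ℂ E) :
    (fun x : E [⋀^Fin k]→L[ℝ] ℂ ↦ (hasLefschetzProperty_lefschetzG hη).weylOperator isZGrading_countingG (GForm.of k x) m) ''
        {x | IsOfTypeAt r s x} = {y : E [⋀^Fin m]→L[ℝ] ℂ | IsOfTypeAt r' s' y} := by
  have h2 := finrank_complex_mul_two Φ e
  refine Set.Subset.antisymm ?_ fun y hy ↦ ?_
  · rintro _ ⟨x, hx, rfl⟩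
    exact hR.isOfTypeAt_weylOperator_of Φ hη e h hx hr' hs'
  · -- `x := (−1)^{|k−g|} w(y)_k` has type `(r, s)` and `w(x)_m = y`
    set W := (hasLefschetzProperty_lefschetzG hη).weylOperator isZGrading_countingG with hW
    have h' : m + k = N := by omega
    have hWy : W (GForm.of m y) = GForm.of k (W (GForm.of m y) k) := weylOperator_of_eq_of hη (by omega) y
    refine ⟨((-1 : ℂ) ^ ((k : ℤ) - (finrank ℂ E : ℤ)).natAbs) • W (GForm.of m y) k,
      (hR.isOfTypeAt_weylOperator_of Φ hη e h' hy (by omega) (by omega)).smul _, ?_⟩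
    show W (GForm.of k (((-1 : ℂ) ^ ((k : ℤ) - (finrank ℂ E : ℤ)).natAbs) • W (GForm.of m y) k)) m = y
    rw [GForm.of_smul, map_smul, ← hWy, hW,
      (hasLefschetzProperty_lefschetzG hη).weylOperator_weylOperator_apply_of_mem isZGrading_countingG
        (of_mem_degreeSpace_countingG (E := E) m y), smul_smul,
      show ((m : ℤ) - (finrank ℂ E : ℤ)).natAbs = ((k : ℤ) - (finrank ℂ E : ℤ)).natAbs by omega, neg_one_pow_natAbs_mul_self₅₈,
      one_smul, GForm.of_apply_self]

omit [Fintype ι] [DecidableEq ι] in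
/-- **`w : H^{r,s}(X) → H^{g−s,g−r}(X)` is injective on each Hodge summand** (indeed on all of `Hᵏ`: `w² = ±1`), `k + m = 2g`.
[cite: Andre1996Motifs, §1.2 (p. 11)] -/
theorem weylOperator_of_apply_injective (hη : ∀ v : E, v ≠ 0 → ∃ w : E, η ![v, w] ≠ 0) {k m : ℕ} (h : k + m = 2 * finrank ℂ E) :
    Function.Injective fun x : E [⋀^Fin k]→L[ℝ] ℂ ↦
      (hasLefschetzProperty_lefschetzG hη).weylOperator isZGrading_countingG (GForm.of k x) m := by
  intro x x' hxx'
  have hx := weylOperator_of_eq_of hη h x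
  have hx' := weylOperator_of_eq_of hη h x'
  have h1 : (hasLefschetzProperty_lefschetzG hη).weylOperator isZGrading_countingG (GForm.of k x) =
      (hasLefschetzProperty_lefschetzG hη).weylOperator isZGrading_countingG (GForm.of k x') := by
    rw [hx, hx']; exact congrArg (GForm.of m) hxx'
  have h2 := congrArg ((hasLefschetzProperty_lefschetzG hη).weylOperator isZGrading_countingG) h1
  rw [(hasLefschetzProperty_lefschetzG hη).weylOperator_weylOperator_apply_of_mem isZGrading_countingG (of_mem_degreeSpace_countingG k x),
    (hasLefschetzProperty_lefschetzG hη).weylOperator_weylOperator_apply_of_mem isZGrading_countingG (of_mem_degreeSpace_countingG k x')]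
    at h2
  have h3 := congr_fun (smul_right_injective (GForm E ℂ) (pow_ne_zero _ (neg_ne_zero.2 one_ne_zero)) h2) k
  rwa [GForm.of_apply_self, GForm.of_apply_self] at h3

end Image

end ComplexTorus

end Literature.Geometry.Kaehler

end
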